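import Summits.Ventures.GridStability.Models.RelativeSwingLFFOffDiag
import Summits.Ventures.GridStability.Models.RelativeSwingLFFLines
import Summits.Ventures.GridStability.Models.RecastAngles

/-!
# WSCC9 lossless variant for the LFF producer pilot (lead 2026-08-27T01:19:25Z, P1): typed object + LFF bridge instance

Venture GRIDFUSION, seat gridfusion-model-1; DATA = model-4's h12 block (`Models/WSCC9.lean` p464217,
`WSCC9.postB_rel`: relative-speed layout, reference machine 1, block-C circle points). Lead 01:19:25Z
«PRODUCER SEQUENCING (P1): … an LFF PRODUCER PILOT on the WSCC9 uniform-λ variant WITH TRANSFER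
CONDUCTANCES DROPPED (RULING 13 relative coordinates) … label "MV-RD / synthetic lossless variant of the
printed 9-bus" — a PIPELINE demonstration, not a 9-bus sentence».

THIS IS A PIPELINE / CENSUS OBJECT (MODELLED; MV-2L synthetic + MV-RD + MV-λ + MV-h12), NOT the WSCC
9-bus system: `WSCC9.postB_relL` = `WSCC9.postB_rel` with the off-diagonal conductance couplings set to
zero (self terms kept; they only move the constants `P′`). Consequences declared: the REDEFINED
injections `P′_i = P_e^{lossless}_i(δ*)` (`postB_relL_Pprime`, floats ≈ [0.3058, 1.2784, 0.4453] vs the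
conductance-carrying block-C values ≈ [0.6085, 1.6009, 0.8363]) — the dropped transfer conductances carried load
(MV-RD); angles of record unchanged. What the LFF producer gets, all in the kernel:
* `postB_relL_transferConductance_eq_zero`, `postB_relL_B_symm` — the lossless/reciprocal hypotheses of
  `RecastData.hasDerivWithinAt_lffState` as `decide`d facts;
* `postB_relL_eqData`, `postB_relL_M_ne_zero` — A1 data discharged;
* `WSCC9.lffSystem lam` := `postB_relL.lffSystem lam postB_relL.angleOf` — THE `LyapunovFunctionFamily.System`
  (lit-6 p481800 `relativeSwing`) to certify: states `Fin 2 ⊕ Fin 2` (`u₂, u₃; ν₂, ν₃`), lines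
  `Fin 3 × Fin 3` (9 ordered pairs; weights `w_{(i,j)} = C_ij/2`, `E_{(i,j),m} = [i = m+1] − [j = m+1]`,
  `δ*_{(i,j)} = θ*_i − θ*_j` with `θ* = postB_relL.angleOf`), `M' = (M₂, M₃)`, `M_ref = M₁`, `A_d = −λ·1`;
  `CB = 0` and `ker E = 0` are lit-6's `relativeSwing_C_mul_B` / `relativeSwing_obs` with
  `RecastData.lffE_injective_aux`;
* `WSCC9.hasDerivWithinAt_lffState` — HYPOTHESIS-FREE: along every solution of
  `postB_relL.toModelRel lam a′` (any `a′`), the relative state solves `(WSCC9.lffSystem lam).field`, so a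
  certificate for `WSCC9.lffSystem lam` (lit-6 `Certificate.well_subset_regionOfAttraction…`) is an
  a-priori statement about every solution of this typed model.
* `WSCC9.lffSystemOff lam` — the SAME dynamics on the OFF-DIAGONAL line set (6 ordered pairs, LMI
  dimension `2·2 + 6 = 10`) with ALL WEIGHTS POSITIVE (`WSCC9.lffWo_pos`, from `C_ij > 0` by `decide`) —
  the presentation to use with lit-6's closed forms (`relativeClosedForm`, p483522, needs `0 < w`);
  `WSCC9.hasDerivWithinAt_lffState_off` is its hypothesis-free bridge, `lffSystemOff_C_mul_B` /
  `lffSystemOff_obs` its structural facts (`Models/RelativeSwingLFFOffDiag.lean`).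
The producer still owes (per lit-6's interface 00:58:32Z): the exact `(Q, K, H, ε)` with the two PSD
facts (or the closed form's scalar side conditions) and the level inequality (angle enclosures:
`Models/AngleEnclosure.lean`). CERTIFIED: nothing here. No stability claim.
-/

noncomputable section

namespace Summit.Ventures.GridStability.Models

namespace WSCC9

open Literature.MathematicalPhysics.PowerSystems

/-- «WSCC9-postB-lossless» data: `postB_rel` with transfer conductances dropped (`G_ij := 0`, `i ≠ j`;
`G_ii` kept). MODELLED: MV-2L synthetic + MV-RD + MV-h12 (pipeline object, lead P1). -/
def postB_relL : RecastData 2 :=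
  { postB_rel with G := fun i j => if i = j then G_postB i j else 0 }

/-- Circle points unchanged (block C): exact, reference `(0, 1)`. -/
theorem postB_relL_circle :
    (∀ i : Fin 3, postB_relL.s i ^ 2 + postB_relL.c i ^ 2 = 1) ∧ postB_relL.s 0 = 0 ∧
      postB_relL.c 0 = 1 :=
  postB_rel_circle

/-- Inertias nonzero. -/
theorem postB_relL_M_ne_zero : ∀ i, postB_relL.M i ≠ 0 := postB_rel_M_ne_zero

/-- MV-2L as a fact: every transfer conductance of the object vanishes. -/
theorem postB_relL_transferConductance_eq_zero :
    ∀ i j : Fin 3, i ≠ j → postB_relL.G i j = 0 := by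
  intro i j hij; simp [postB_relL, hij]

/-- Reciprocal susceptance couplings (h12 rounding of a symmetric exact matrix). -/
theorem postB_relL_B_symm : ∀ i j : Fin 3, postB_relL.B i j = postB_relL.B j i := by decide +kernel

/-- The A1 hypotheses hold with the angles `angleOf`. -/
theorem postB_relL_eqData : postB_relL.EqData postB_relL.angleOf :=
  postB_relL.eqData_angleOf postB_relL_circle.1 postB_relL_circle.2.1 postB_relL_circle.2.2

/-- The REDEFINED equilibrium injections of the lossless variant, computed in Lean
(floats ≈ [0.3058, 1.2784, 0.4453]; MV-RD versus the conductance-carrying block ≈ [0.6085, 1.6009, 0.8363]: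
the dropped transfer conductances carried load). -/
theorem postB_relL_Pprime :
    postB_relL.Pprime 0 = (2060804822588565318013507531199 : ℚ)/6738302164864273613000000000000 ∧
    postB_relL.Pprime 1 = (8614442188648700551109639044187 : ℚ)/6738302164864273613000000000000 ∧
    postB_relL.Pprime 2 = (1500343135564424192147897185353 : ℚ)/3369151082432136806500000000000 := by
  refine ⟨?_, ?_, ?_⟩ <;> decide +kernel

/-- **The LFF system of record for the P1 pilot**: lit-6's `relativeSwing` instantiated with the
WSCC9 lossless data, uniform damping ratio `λ`, equilibrium angles `angleOf`. -/
def lffSystem (lam : ℚ) : LyapunovFunctionFamily.System (Fin 2 ⊕ Fin 2) (Fin 3 × Fin 3) :=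
  postB_relL.lffSystem lam postB_relL.angleOf

/-- `CB = 0` for the pilot system (lit-6). -/
theorem lffSystem_C_mul_B (lam : ℚ) : (lffSystem lam).C * (lffSystem lam).B = 0 :=
  LyapunovFunctionFamily.System.relativeSwing_C_mul_B _ _ _ _ _ _

/-- Observability for the pilot system: `ker E = 0` (identity rows of `lffE`), via lit-6's
`relativeSwing_obs`. -/
theorem lffSystem_obs (lam : ℚ) (x : Fin 2 ⊕ Fin 2 → ℝ) (h1 : (lffSystem lam).C.mulVec x = 0)
    (h2 : (lffSystem lam).C.mulVec ((lffSystem lam).A.mulVec x) = 0) : x = 0 :=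
  LyapunovFunctionFamily.System.relativeSwing_obs _ _ _ _ _ _
    (fun v hv => RecastData.lffE_injective_aux v hv) x h1 h2

/-- **HYPOTHESIS-FREE LFF BRIDGE for the pilot object.** Along every solution `c` of
`postB_relL.toModelRel lam a′` (classical 3-machine model, lossless h12 variant, uniform damping ratio
`λ`, any common acceleration `a′`) on `s`, the relative state `lffState angleOf (c τ)` solves
`(WSCC9.lffSystem lam).field` within `s`. -/
theorem hasDerivWithinAt_lffState (lam : ℚ) (a : ℝ) {c : ℝ → ClassicalSwing.State 3} {s : Set ℝ}
    (hc : (postB_relL.toModelRel lam a).IsSolutionOn c s) {t : ℝ} (ht : t ∈ s) :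
    HasDerivWithinAt (fun τ => RecastData.lffState postB_relL.angleOf (c τ))
      ((lffSystem lam).field (RecastData.lffState postB_relL.angleOf (c t))) s t :=
  postB_relL.hasDerivWithinAt_lffState lam a postB_relL_transferConductance_eq_zero postB_relL_B_symm
    postB_relL_eqData postB_relL_M_ne_zero hc ht

/-! ### Off-diagonal presentation (positive weights) -/

/-- All transfer couplings `C_ij = E_iE_jB_ij` (`i ≠ j`) of the WSCC9 h12 data are positive. -/
theorem postB_relL_Cc_pos : ∀ i j : Fin 3, i ≠ j → 0 < postB_relL.Cc i j := by decide +kernel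

/-- **The LFF system of record for the P1 pilot, positive-weight presentation**: lit-6's
`relativeSwing` on the 6 off-diagonal ordered pairs. -/
def lffSystemOff (lam : ℚ) : LyapunovFunctionFamily.System (Fin 2 ⊕ Fin 2) (RecastData.LffPair 2) :=
  postB_relL.lffSystemOff lam postB_relL.angleOf

/-- Every line weight of the pilot system is positive (`hw` of lit-6's closed-form certificates). -/
theorem lffWo_pos : ∀ k : RecastData.LffPair 2, 0 < postB_relL.lffWo k :=
  postB_relL.lffWo_pos postB_relL_Cc_pos

/-- `CB = 0` (positive-weight presentation). -/
theorem lffSystemOff_C_mul_B (lam : ℚ) : (lffSystemOff lam).C * (lffSystemOff lam).B = 0 :=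
  postB_relL.lffSystemOff_C_mul_B lam _

/-- Observability (`ker E = 0`, positive-weight presentation). -/
theorem lffSystemOff_obs (lam : ℚ) (x : Fin 2 ⊕ Fin 2 → ℝ) (h1 : (lffSystemOff lam).C.mulVec x = 0)
    (h2 : (lffSystemOff lam).C.mulVec ((lffSystemOff lam).A.mulVec x) = 0) : x = 0 :=
  postB_relL.lffSystemOff_obs lam _ x h1 h2

/-- **HYPOTHESIS-FREE LFF BRIDGE, positive-weight presentation.** Along every solution `c` of
`postB_relL.toModelRel lam a′` on `s`, the relative state solves `(WSCC9.lffSystemOff lam).field`. -/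
theorem hasDerivWithinAt_lffState_off (lam : ℚ) (a : ℝ) {c : ℝ → ClassicalSwing.State 3} {s : Set ℝ}
    (hc : (postB_relL.toModelRel lam a).IsSolutionOn c s) {t : ℝ} (ht : t ∈ s) :
    HasDerivWithinAt (fun τ => RecastData.lffState postB_relL.angleOf (c τ))
      ((lffSystemOff lam).field (RecastData.lffState postB_relL.angleOf (c t))) s t :=
  postB_relL.hasDerivWithinAt_lffState_off lam a postB_relL_transferConductance_eq_zero postB_relL_B_symm
    postB_relL_eqData postB_relL_M_ne_zero hc ht

/-! ### Unordered-lines presentation (3 lines, full weight) — APPEND 2026-08-27 (lit-6's preferred form) -/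

/-- **The LFF system of record for the P1 pilot, 3-line presentation**: lit-6's `relativeSwing` on the
unordered machine pairs `(1,2), (1,3), (2,3)` (as `i < j` in record indices `0 < 1 < 2`), FULL weights
`w = C_ij = E_iE_jB_ij`, `E` rows `θ_i − θ_j` with `θ_0 ≡ 0` (reference = machine 1 of the printed
numbering). LMI-free closed forms see 3 lines; an SDP producer sees LMI dimension `2·2 + 3 = 7`. -/
def lffSystemU (lam : ℚ) : LyapunovFunctionFamily.System (Fin 2 ⊕ Fin 2) (RecastData.LffLine 2) :=
  postB_relL.lffSystemU lam postB_relL.angleOf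

/-- Every line weight of the 3-line presentation is positive. -/
theorem lffWu_pos : ∀ k : RecastData.LffLine 2, 0 < postB_relL.lffWu k :=
  postB_relL.lffWu_pos postB_relL_Cc_pos

/-- `CB = 0` (3-line presentation). -/
theorem lffSystemU_C_mul_B (lam : ℚ) : (lffSystemU lam).C * (lffSystemU lam).B = 0 :=
  postB_relL.lffSystemU_C_mul_B lam _

/-- Observability (`ker E = 0`, 3-line presentation). -/
theorem lffSystemU_obs (lam : ℚ) (x : Fin 2 ⊕ Fin 2 → ℝ) (h1 : (lffSystemU lam).C.mulVec x = 0)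
    (h2 : (lffSystemU lam).C.mulVec ((lffSystemU lam).A.mulVec x) = 0) : x = 0 :=
  postB_relL.lffSystemU_obs lam _ x h1 h2

/-- **HYPOTHESIS-FREE LFF BRIDGE, 3-line presentation.** Along every solution `c` of
`postB_relL.toModelRel lam a′` on `s`, the relative state solves `(WSCC9.lffSystemU lam).field`. -/
theorem hasDerivWithinAt_lffState_lines (lam : ℚ) (a : ℝ) {c : ℝ → ClassicalSwing.State 3}
    {s : Set ℝ} (hc : (postB_relL.toModelRel lam a).IsSolutionOn c s) {t : ℝ} (ht : t ∈ s) :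
    HasDerivWithinAt (fun τ => RecastData.lffState postB_relL.angleOf (c τ))
      ((lffSystemU lam).field (RecastData.lffState postB_relL.angleOf (c t))) s t :=
  postB_relL.hasDerivWithinAt_lffState_lines lam a postB_relL_transferConductance_eq_zero
    postB_relL_B_symm postB_relL_eqData postB_relL_M_ne_zero hc ht

end WSCC9

end Summit.Ventures.GridStability.Models

end
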